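import Mathlib
import HarnessLib
import Literature.Geometry.DiscreteGeometry.BondGraph
import Literature.Geometry.DiscreteGeometry.KissingPatterns

/-!
# `stub_realBall` (crux `SoftLayerPropagation`, line `Sketch` v7): the `45°` cap lemma and the
# five-move covering of the shadow `63/20`-ball by the graph `5`-ball

Route `PricedLinkCensus`, crux `SoftLayerPropagation` (stmt-AtomisticToContinuum-14233), line
`Sketch`, helper file for the registered stub `stub_realBall` (the real `3·nn_i`-ball lies in the
graph `5`-ball with shadow within `33/10`).  Two elementary, metric-free facts about exact
developments, used by the reduction `realBall_of_tracking`
(`…RealBallReduction.lean`):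

* **The `45°` cap lemma** (`RealBall.exists_mem_pattern_norm_le_inner`): for every vector `d` and
  each of the two kissing patterns `P` (FCC cuboctahedron, HCP anticuboctahedron) there is a
  pattern point `p` with `‖d‖ ≤ √2 ⟪p, d⟫`, i.e. within `45°` of `d` — the inradius of both
  polytopes is `1/√2` (the square faces).  FCC: keep the two coordinates of largest modulus with
  their signs; HCP: the nine pattern points with `x + y + z ≥ 0` are FCC points, and the reflection
  in the hexagonal plane `x + y + z = 0` is a symmetry of the HCP pattern exchanging the two half
  spaces, so the FCC case applies on `x + y + z ≥ 0` (where an FCC witness in the lower triangle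
  forces `d = 0`) and is reflected otherwise.  Consequence
  (`RealBall.exists_mem_pattern_norm_sub_sq_le`): for any linear isometry `Q`,
  some `p ∈ P` has `‖d - Q p‖² ≤ ‖d‖² - √2 ‖d‖ + 1`.
* **Five moves** (`RealBall.exists_walk_norm_sub_le`): if every site of the graph `5`-ball about
  `i` has an exact star (`D '' N(j) = D j + Q '' P`), then every point `x` of shadow space with
  `‖x - D i‖ ≤ 63/20` is within `31/40` of the shadow `D v` of some site `v` of the graph `5`-ball:
  starting at `i`, move five times to the bond-neighbour whose exact shadow direction is within
  `45°` of the direction to `x`; the distance to `x` obeys `ρ ↦ √(ρ² - √2 ρ + 1)`, and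
  `3.15 ↦ 2.544 ↦ 1.969 ↦ 1.447 ↦ 1.024 ↦ 0.775` (a move is skipped once the distance is already
  below the next threshold, so the walk has length `≤ 5`).

No stacking structure, no charge-freeness and no metric input enter here.  All [folklore].
-/

noncomputable section

namespace Summit.AtomisticToContinuum.Crystallization.Theorems

namespace RealBall

open Literature.Geometry.DiscreteGeometry RealInnerProductSpace

/-! ### Coordinates -/

/-- The inner product with an integer vector, in coordinates. [folklore] -/
theorem inner_intVec (u : Fin 3 → ℤ) (d : EuclideanSpace ℝ (Fin 3)) :
    ⟪intVec u, d⟫ = u 0 * d 0 + u 1 * d 1 + u 2 * d 2 := by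
  simp [PiLp.inner_apply, Fin.sum_univ_three, intVec, mul_comm]

/-- A sign `σ = ±1` with `σ a = |a|`. [folklore] -/
theorem exists_sign_mul_eq_abs (a : ℝ) : ∃ σ : ℤ, (σ = 1 ∨ σ = -1) ∧ (σ : ℝ) * a = |a| := by
  rcases le_total 0 a with h | h
  · exact ⟨1, Or.inl rfl, by simp [abs_of_nonneg h]⟩
  · exact ⟨-1, Or.inr rfl, by simp [abs_of_nonpos h]⟩

/-- `√(a² + b² + c²) ≤ |a| + |b|` when `|c|` is the smallest modulus (`c² ≤ |a| |b| ≤ 2 |a| |b|`).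
[folklore] -/
theorem sqrt_le_abs_add_abs {a b c : ℝ} (hca : |c| ≤ |a|) (hcb : |c| ≤ |b|) :
    Real.sqrt (a ^ 2 + b ^ 2 + c ^ 2) ≤ |a| + |b| := by
  rw [Real.sqrt_le_left (by positivity)]
  nlinarith [abs_nonneg c, sq_abs a, sq_abs b, sq_abs c,
    mul_le_mul hca hcb (abs_nonneg c) (abs_nonneg a)]

/-! ### The `45°` cap lemma for the FCC pattern -/

/-- **FCC cap lemma, integer form.**  For every `d` some `u ∈ fccInt` (a permutation of
`(±1, ±1, 0)`) has `‖d‖ ≤ u · d`: keep the two coordinates of largest modulus, with their signs.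
[folklore] -/
theorem exists_mem_fccInt_norm_le (d : EuclideanSpace ℝ (Fin 3)) :
    ∃ u ∈ fccInt, ‖d‖ ≤ u 0 * d 0 + u 1 * d 1 + u 2 * d 2 := by
  have hn : ‖d‖ = Real.sqrt (d 0 ^ 2 + d 1 ^ 2 + d 2 ^ 2) := by
    rw [← Real.sqrt_sq (norm_nonneg d), EuclideanSpace.real_norm_sq_eq, Fin.sum_univ_three]
  obtain ⟨σ0, h0, e0⟩ := exists_sign_mul_eq_abs (d 0)
  obtain ⟨σ1, h1, e1⟩ := exists_sign_mul_eq_abs (d 1)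
  obtain ⟨σ2, h2, e2⟩ := exists_sign_mul_eq_abs (d 2)
  rcases le_total |d 2| |d 0| with h20 | h02
  · rcases le_total |d 2| |d 1| with h21 | h12
    · -- drop coordinate `2`
      refine ⟨![σ0, σ1, 0], ?_, ?_⟩
      · rcases h0 with rfl | rfl <;> rcases h1 with rfl | rfl <;> decide
      · simp only [Matrix.cons_val_zero, Matrix.cons_val_one, Matrix.head_cons, Matrix.cons_val_two,
          Matrix.tail_cons, Int.cast_zero, zero_mul, add_zero, e0, e1]
        rw [hn]; exact sqrt_le_abs_add_abs h20 h21
    · -- `|d 1| ≤ |d 2| ≤ |d 0|`: drop coordinate `1`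
      refine ⟨![σ0, 0, σ2], ?_, ?_⟩
      · rcases h0 with rfl | rfl <;> rcases h2 with rfl | rfl <;> decide
      · simp only [Matrix.cons_val_zero, Matrix.cons_val_one, Matrix.head_cons, Matrix.cons_val_two,
          Matrix.tail_cons, Int.cast_zero, zero_mul, add_zero, e0, e2]
        rw [hn]
        calc Real.sqrt (d 0 ^ 2 + d 1 ^ 2 + d 2 ^ 2)
            = Real.sqrt (d 0 ^ 2 + d 2 ^ 2 + d 1 ^ 2) := by ring_nf
          _ ≤ |d 0| + |d 2| := sqrt_le_abs_add_abs (h12.trans h20) h12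
  · rcases le_total |d 0| |d 1| with h01 | h10
    · -- drop coordinate `0`
      refine ⟨![0, σ1, σ2], ?_, ?_⟩
      · rcases h1 with rfl | rfl <;> rcases h2 with rfl | rfl <;> decide
      · simp only [Matrix.cons_val_zero, Matrix.cons_val_one, Matrix.head_cons, Matrix.cons_val_two,
          Matrix.tail_cons, Int.cast_zero, zero_mul, zero_add, e1, e2]
        rw [hn]
        calc Real.sqrt (d 0 ^ 2 + d 1 ^ 2 + d 2 ^ 2)
            = Real.sqrt (d 1 ^ 2 + d 2 ^ 2 + d 0 ^ 2) := by ring_nf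
          _ ≤ |d 1| + |d 2| := sqrt_le_abs_add_abs h01 h02
    · -- `|d 1| ≤ |d 0| ≤ |d 2|`: drop coordinate `1`
      refine ⟨![σ0, 0, σ2], ?_, ?_⟩
      · rcases h0 with rfl | rfl <;> rcases h2 with rfl | rfl <;> decide
      · simp only [Matrix.cons_val_zero, Matrix.cons_val_one, Matrix.head_cons, Matrix.cons_val_two,
          Matrix.tail_cons, Int.cast_zero, zero_mul, add_zero, e0, e2]
        rw [hn]
        calc Real.sqrt (d 0 ^ 2 + d 1 ^ 2 + d 2 ^ 2)
            = Real.sqrt (d 0 ^ 2 + d 2 ^ 2 + d 1 ^ 2) := by ring_nf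
          _ ≤ |d 0| + |d 2| := sqrt_le_abs_add_abs h10 (h10.trans h02)

/-- The degenerate case: a vector of nonnegative coordinate sum lying within `45°` of a
lower-triangle direction `(-1, -1, 0)` is zero. [folklore] -/
theorem norm_eq_zero_of_lower {n a b c : ℝ} (hn : 0 ≤ n) (hsq : n ^ 2 = a ^ 2 + b ^ 2 + c ^ 2)
    (hle : n ≤ -a - b) (hs : 0 ≤ a + b + c) : n = 0 := by
  have hc : n ≤ c := by linarith
  have hc2 : n ^ 2 ≤ c ^ 2 := pow_le_pow_left₀ hn hc 2
  have hab : a ^ 2 + b ^ 2 ≤ 0 := by linarith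
  have ha : a = 0 := by nlinarith [sq_nonneg a, sq_nonneg b]
  have hb : b = 0 := by nlinarith [sq_nonneg a, sq_nonneg b]
  subst ha; subst hb
  linarith

/-- **FCC cap lemma on the upper half space**: if `d₀ + d₁ + d₂ ≥ 0` the witness can be taken
among the nine FCC vectors with nonnegative coordinate sum (a lower-triangle witness forces `d = 0`).
[folklore] -/
theorem exists_mem_fccInt_norm_le_of_sum_nonneg (d : EuclideanSpace ℝ (Fin 3)) (hs : 0 ≤ d 0 + d 1 + d 2) :
    ∃ u ∈ fccInt, 0 ≤ u 0 + u 1 + u 2 ∧ ‖d‖ ≤ u 0 * d 0 + u 1 * d 1 + u 2 * d 2 := by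
  obtain ⟨u, hu, hle⟩ := exists_mem_fccInt_norm_le d
  by_cases hsum : 0 ≤ u 0 + u 1 + u 2
  · exact ⟨u, hu, hsum, hle⟩
  · have hn2 : ‖d‖ ^ 2 = d 0 ^ 2 + d 1 ^ 2 + d 2 ^ 2 := by
      rw [EuclideanSpace.real_norm_sq_eq, Fin.sum_univ_three]
    have hn0 := norm_nonneg d
    have hd : ‖d‖ = 0 := by
      simp only [fccInt, Finset.mem_insert, Finset.mem_singleton] at hu
      rcases hu with rfl | rfl | rfl | rfl | rfl | rfl | rfl | rfl | rfl | rfl | rfl | rfl <;>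
        simp at hsum hle
      · exact norm_eq_zero_of_lower hn0 hn2 (by linarith) hs
      · exact norm_eq_zero_of_lower (a := d 0) (b := d 2) (c := d 1) hn0 (by rw [hn2]; ring)
          (by linarith) (by linarith)
      · exact norm_eq_zero_of_lower (a := d 1) (b := d 2) (c := d 0) hn0 (by rw [hn2]; ring)
          (by linarith) (by linarith)
    refine ⟨![1, 1, 0], by decide, by simp, ?_⟩
    have : d = 0 := norm_eq_zero.1 hd
    subst this
    simp

/-! ### The `45°` cap lemma for the HCP pattern (by reflection) -/

/-- `3 ·` an upper FCC vector is an HCP vector. [folklore] -/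
theorem three_mul_mem_hcpInt : ∀ u ∈ fccInt, 0 ≤ u 0 + u 1 + u 2 →
    ![3 * u 0, 3 * u 1, 3 * u 2] ∈ hcpInt := by decide

/-- The reflection of `3 ·` an upper FCC vector in the plane `x + y + z = 0` is an HCP vector
(the hexagon is fixed, the upper triangle goes to the lower HCP triangle). [folklore] -/
theorem refl_mem_hcpInt : ∀ u ∈ fccInt, 0 ≤ u 0 + u 1 + u 2 →
    ![3 * u 0 - 2 * (u 0 + u 1 + u 2), 3 * u 1 - 2 * (u 0 + u 1 + u 2),
      3 * u 2 - 2 * (u 0 + u 1 + u 2)] ∈ hcpInt := by decide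

/-- **HCP cap lemma, integer form.**  For every `d` some `u ∈ hcpInt` (squared norm `18`) has
`3 ‖d‖ ≤ u · d`.  On `d₀ + d₁ + d₂ ≥ 0` use the upper FCC witness; otherwise reflect `d` in the
hexagonal plane (an isometry preserving the coordinate form of the claim) and reflect the witness
back. [folklore] -/
theorem exists_mem_hcpInt_norm_le (d : EuclideanSpace ℝ (Fin 3)) :
    ∃ u ∈ hcpInt, 3 * ‖d‖ ≤ u 0 * d 0 + u 1 * d 1 + u 2 * d 2 := by
  rcases le_total 0 (d 0 + d 1 + d 2) with hs | hs
  · obtain ⟨u, hu, hsum, hle⟩ := exists_mem_fccInt_norm_le_of_sum_nonneg d hs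
    refine ⟨_, three_mul_mem_hcpInt u hu hsum, ?_⟩
    simp only [Matrix.cons_val_zero, Matrix.cons_val_one, Matrix.head_cons, Matrix.cons_val_two,
      Matrix.tail_cons, Int.cast_mul, Int.cast_ofNat]
    linarith
  · -- reflect `d` in the hexagonal plane `x + y + z = 0`
    set s := d 0 + d 1 + d 2 with hs_def
    set d' : EuclideanSpace ℝ (Fin 3) := !₂[d 0 - 2 / 3 * s, d 1 - 2 / 3 * s, d 2 - 2 / 3 * s] with hd'
    have h0 : d' 0 = d 0 - 2 / 3 * s := by simp [hd']
    have h1 : d' 1 = d 1 - 2 / 3 * s := by simp [hd']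
    have h2 : d' 2 = d 2 - 2 / 3 * s := by simp [hd']
    have hs' : 0 ≤ d' 0 + d' 1 + d' 2 := by rw [h0, h1, h2]; linarith
    obtain ⟨u, hu, hsum, hle⟩ := exists_mem_fccInt_norm_le_of_sum_nonneg d' hs'
    have hnorm : ‖d'‖ = ‖d‖ := by
      have e1 : ‖d'‖ ^ 2 = d' 0 ^ 2 + d' 1 ^ 2 + d' 2 ^ 2 := by
        rw [EuclideanSpace.real_norm_sq_eq, Fin.sum_univ_three]
      have e2 : ‖d‖ ^ 2 = d 0 ^ 2 + d 1 ^ 2 + d 2 ^ 2 := by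
        rw [EuclideanSpace.real_norm_sq_eq, Fin.sum_univ_three]
      rw [h0, h1, h2] at e1
      have : ‖d'‖ ^ 2 = ‖d‖ ^ 2 := by rw [e1, e2, hs_def]; ring
      exact (sq_eq_sq₀ (norm_nonneg _) (norm_nonneg _)).1 this
    refine ⟨_, refl_mem_hcpInt u hu hsum, ?_⟩
    simp only [Matrix.cons_val_zero, Matrix.cons_val_one, Matrix.head_cons, Matrix.cons_val_two,
      Matrix.tail_cons, Int.cast_sub, Int.cast_mul, Int.cast_add, Int.cast_ofNat]
    rw [h0, h1, h2, hnorm] at hle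
    have key : (3 * (u 0 : ℝ) - 2 * (u 0 + u 1 + u 2)) * d 0 +
        (3 * (u 1 : ℝ) - 2 * (u 0 + u 1 + u 2)) * d 1 +
        (3 * (u 2 : ℝ) - 2 * (u 0 + u 1 + u 2)) * d 2 =
        3 * ((u 0 : ℝ) * (d 0 - 2 / 3 * s) + u 1 * (d 1 - 2 / 3 * s) + u 2 * (d 2 - 2 / 3 * s)) := by
      simp only [hs_def]; ring
    rw [key]
    linarith

/-! ### The cap lemma for the two kissing patterns -/

/-- **The `45°` cap lemma.**  For `P` the FCC or the HCP kissing pattern and every vector `d`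
there is `p ∈ P` with `‖d‖ ≤ √2 ⟪p, d⟫` (the angle between `p` and `d` is at most `45°`):
both the cuboctahedron and the anticuboctahedron of circumradius `1` contain the ball of radius
`1/√2`. [folklore] -/
theorem exists_mem_pattern_norm_le_inner {P : Finset (EuclideanSpace ℝ (Fin 3))}
    (hP : P = fccKissingPattern ∨ P = hcpKissingPattern) (d : EuclideanSpace ℝ (Fin 3)) :
    ∃ p ∈ P, ‖d‖ ≤ Real.sqrt 2 * ⟪p, d⟫ := by
  have h2 : Real.sqrt 2 ≠ 0 := by positivity
  rcases hP with rfl | rfl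
  · obtain ⟨u, hu, hle⟩ := exists_mem_fccInt_norm_le d
    refine ⟨(Real.sqrt ((2 : ℕ) : ℝ))⁻¹ • intVec u, Finset.mem_image.2 ⟨u, hu, rfl⟩, ?_⟩
    rw [Nat.cast_ofNat, real_inner_smul_left, inner_intVec, ← mul_assoc, mul_inv_cancel₀ h2,
      one_mul]
    exact hle
  · obtain ⟨u, hu, hle⟩ := exists_mem_hcpInt_norm_le d
    refine ⟨(Real.sqrt ((18 : ℕ) : ℝ))⁻¹ • intVec u, Finset.mem_image.2 ⟨u, hu, rfl⟩, ?_⟩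
    have h18 : Real.sqrt ((18 : ℕ) : ℝ) = 3 * Real.sqrt 2 := by
      rw [show ((18 : ℕ) : ℝ) = 3 ^ 2 * 2 by norm_num, Real.sqrt_mul (by norm_num),
        Real.sqrt_sq (by norm_num)]
    rw [h18, real_inner_smul_left, inner_intVec, ← mul_assoc, mul_inv, mul_comm (3 : ℝ)⁻¹,
      ← mul_assoc, mul_inv_cancel₀ h2, one_mul]
    linarith

/-- **One move.**  For `P` the FCC or HCP pattern, any linear isometry `Q` and any `d`, some
`p ∈ P` has `‖d - Q p‖² ≤ ‖d‖² - √2 ‖d‖ + 1` (take `Q p` within `45°` of `d`; `‖Q p‖ = 1`).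
[folklore] -/
theorem exists_mem_pattern_norm_sub_sq_le {P : Finset (EuclideanSpace ℝ (Fin 3))}
    (hP : P = fccKissingPattern ∨ P = hcpKissingPattern) (Q : EuclideanSpace ℝ (Fin 3) →ₗᵢ[ℝ] EuclideanSpace ℝ (Fin 3)) (d : EuclideanSpace ℝ (Fin 3)) :
    ∃ p ∈ P, ‖d - Q p‖ ^ 2 ≤ ‖d‖ ^ 2 - Real.sqrt 2 * ‖d‖ + 1 := by
  set Qe : EuclideanSpace ℝ (Fin 3) ≃ₗᵢ[ℝ] EuclideanSpace ℝ (Fin 3) := Q.toLinearIsometryEquiv rfl with hQe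
  obtain ⟨p, hp, hle⟩ := exists_mem_pattern_norm_le_inner hP (Qe.symm d)
  refine ⟨p, hp, ?_⟩
  have hp1 : ‖p‖ = 1 := by
    rcases hP with rfl | rfl
    · exact norm_eq_one_of_mem_fccKissingPattern hp
    · exact norm_eq_one_of_mem_hcpKissingPattern hp
  have hQp : ‖Q p‖ = 1 := by rw [Q.norm_map, hp1]
  have hQe_apply : Qe p = Q p := rfl
  have hinner : ⟪p, Qe.symm d⟫ = ⟪Q p, d⟫ := by
    rw [← Qe.inner_map_map, hQe_apply, LinearIsometryEquiv.apply_symm_apply]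
  have hn : ‖Qe.symm d‖ = ‖d‖ := Qe.symm.norm_map d
  rw [hinner, hn] at hle
  have hs2 : Real.sqrt 2 * Real.sqrt 2 = 2 := Real.mul_self_sqrt (by norm_num)
  have hs0 : 0 ≤ Real.sqrt 2 := Real.sqrt_nonneg 2
  have h2 := mul_le_mul_of_nonneg_left hle hs0
  rw [← mul_assoc, hs2] at h2
  rw [norm_sub_sq_real, hQp, real_inner_comm]
  linarith

/-! ### Five moves in an exact development -/

/-- **Arithmetic of one move.**  If `b ≤ ρ ≤ a`, `b < a`, `c b ≥ 1` and `a² - c a + 1 ≤ b²`, then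
`ρ² - c ρ + 1 ≤ b²` (the quadratic is convex, so its maximum on `[b, a]` is at an end point;
at `b` it is `≤ b²` because `c b ≥ 1`). [folklore] -/
theorem quad_step {c ρ a b : ℝ} (hbρ : b ≤ ρ) (hρa : ρ ≤ a) (hba : b < a) (hcb : 1 ≤ c * b)
    (hqa : a ^ 2 - c * a + 1 ≤ b ^ 2) : ρ ^ 2 - c * ρ + 1 ≤ b ^ 2 := by
  have key : (a - b) * (b ^ 2 - (ρ ^ 2 - c * ρ + 1)) =
      (a - b) * ((ρ - b) * (a - ρ)) + (a - ρ) * (c * b - 1) +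
        (ρ - b) * (b ^ 2 - (a ^ 2 - c * a + 1)) := by
    ring
  have h1 : 0 ≤ (a - b) * ((ρ - b) * (a - ρ)) :=
    mul_nonneg (by linarith) (mul_nonneg (by linarith) (by linarith))
  have h2 : 0 ≤ (a - ρ) * (c * b - 1) := mul_nonneg (by linarith) (by linarith)
  have h3 : 0 ≤ (ρ - b) * (b ^ 2 - (a ^ 2 - c * a + 1)) := mul_nonneg (by linarith) (by linarith)
  have h4 : 0 ≤ (a - b) * (b ^ 2 - (ρ ^ 2 - c * ρ + 1)) := by rw [key]; linarith
  have h5 := (mul_nonneg_iff_of_pos_left (sub_pos.2 hba)).1 h4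
  linarith

variable {N : ℕ} {η : ℝ} {y : Fin N → EuclideanSpace ℝ (Fin 3)}

/-- **One move in the development.**  At a site `j` with an exact star (the star clause of the
development hypothesis of the line, verbatim), for every target `x` some bond-neighbour `k` of `j`
has `‖x - D k‖² ≤ ‖x - D j‖² - √2 ‖x - D j‖ + 1`: the neighbour whose exact shadow direction is
within `45°` of `x - D j`. [folklore] -/
theorem exists_adj_norm_sub_sq_le {D : Fin N → EuclideanSpace ℝ (Fin 3)} {j : Fin N}
    (hstar : ∃ (P : Finset (EuclideanSpace ℝ (Fin 3))) (Q R : EuclideanSpace ℝ (Fin 3) →ₗᵢ[ℝ] EuclideanSpace ℝ (Fin 3)),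
      (P = fccKissingPattern ∨ P = hcpKissingPattern) ∧
      D '' {k | (bondGraph η y).Adj j k} = (fun p => D j + Q p) '' (P : Set (EuclideanSpace ℝ (Fin 3))) ∧
      (∀ k, (bondGraph η y).Adj j k →
        ‖(y k - y j) - nearestDist y j • R (D k - D j)‖ ≤ nearestDist y j / 4) ∧
      (∀ k k', (bondGraph η y).Adj j k → (bondGraph η y).Adj j k' →
        ((bondGraph η y).Adj k k' ↔ dist (D k) (D k') = 1)))
    (x : EuclideanSpace ℝ (Fin 3)) :
    ∃ k, (bondGraph η y).Adj j k ∧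
      ‖x - D k‖ ^ 2 ≤ ‖x - D j‖ ^ 2 - Real.sqrt 2 * ‖x - D j‖ + 1 := by
  obtain ⟨P, Q, -, hP, himg, -, -⟩ := hstar
  obtain ⟨p, hp, hle⟩ := exists_mem_pattern_norm_sub_sq_le hP Q (x - D j)
  have hmem : D j + Q p ∈ (fun p => D j + Q p) '' (P : Set (EuclideanSpace ℝ (Fin 3))) := ⟨p, hp, rfl⟩
  rw [← himg] at hmem
  obtain ⟨k, hk, hkp⟩ := hmem
  refine ⟨k, hk, ?_⟩
  rw [hkp, show x - (D j + Q p) = (x - D j) - Q p by abel]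
  exact hle

/-- **Five moves: the graph `5`-ball shadows the `63/20`-ball to within `31/40`.**  If every
site of the graph `5`-ball about `i` has an exact star (hypothesis of `stub_realBall`, verbatim),
then for every `x` with `‖x - D i‖ ≤ 63/20` there is a site `v` at graph distance `≤ 5` from `i`
with `‖x - D v‖ ≤ 31/40`.  Greedy descent `ρ ↦ √(ρ² - √2 ρ + 1)` through the thresholds
`63/20, 318/125, 1969/1000, 1447/1000, 128/125, 31/40` (with `√2 ≥ 1.41421356`; a move is skipped
when the distance is already below the next threshold). [folklore] -/
theorem exists_walk_norm_sub_le {i : Fin N} {D : Fin N → EuclideanSpace ℝ (Fin 3)}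
    (hD : ∀ j : Fin N, (∃ w : (bondGraph η y).Walk i j, w.length ≤ 5) →
      ∃ (P : Finset (EuclideanSpace ℝ (Fin 3))) (Q R : EuclideanSpace ℝ (Fin 3) →ₗᵢ[ℝ] EuclideanSpace ℝ (Fin 3)),
        (P = fccKissingPattern ∨ P = hcpKissingPattern) ∧
        D '' {k | (bondGraph η y).Adj j k} = (fun p => D j + Q p) '' (P : Set (EuclideanSpace ℝ (Fin 3))) ∧
        (∀ k, (bondGraph η y).Adj j k →
          ‖(y k - y j) - nearestDist y j • R (D k - D j)‖ ≤ nearestDist y j / 4) ∧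
        (∀ k k', (bondGraph η y).Adj j k → (bondGraph η y).Adj j k' →
          ((bondGraph η y).Adj k k' ↔ dist (D k) (D k') = 1)))
    (x : EuclideanSpace ℝ (Fin 3)) (hx : ‖x - D i‖ ≤ 63 / 20) :
    ∃ v : Fin N, (∃ w : (bondGraph η y).Walk i v, w.length ≤ 5) ∧ ‖x - D v‖ ≤ 31 / 40 := by
  set c : ℝ := 141421356 / 100000000 with hc
  have hcs : c ≤ Real.sqrt 2 := by
    rw [hc]; exact le_of_lt ((Real.lt_sqrt (by norm_num)).mpr (by norm_num))
  -- one step of the descent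
  have step : ∀ (m : ℕ) (a b : ℝ), m ≤ 4 → b < a → 71 / 100 ≤ b → a ^ 2 - c * a + 1 ≤ b ^ 2 →
      (∃ u : Fin N, (∃ w : (bondGraph η y).Walk i u, w.length ≤ m) ∧ ‖x - D u‖ ≤ a) →
      ∃ v : Fin N, (∃ w : (bondGraph η y).Walk i v, w.length ≤ m + 1) ∧ ‖x - D v‖ ≤ b := by
    intro m a b hm hba hb hab ⟨u, ⟨w, hw⟩, hu⟩
    by_cases hbu : ‖x - D u‖ ≤ b
    · exact ⟨u, ⟨w, by omega⟩, hbu⟩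
    · have hu5 : ∃ w : (bondGraph η y).Walk i u, w.length ≤ 5 := ⟨w, by omega⟩
      obtain ⟨k, hk, hle⟩ := exists_adj_norm_sub_sq_le (hD u hu5) x
      refine ⟨k, ⟨w.concat hk, by rw [SimpleGraph.Walk.length_concat]; omega⟩, ?_⟩
      have hρ0 : 0 ≤ ‖x - D u‖ := norm_nonneg _
      have hq : ‖x - D u‖ ^ 2 - c * ‖x - D u‖ + 1 ≤ b ^ 2 :=
        quad_step (le_of_lt (not_le.1 hbu)) hu hba (by rw [hc]; linarith) hab
      have hsq : ‖x - D k‖ ^ 2 ≤ b ^ 2 := by nlinarith [mul_le_mul_of_nonneg_right hcs hρ0]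
      exact (pow_le_pow_iff_left₀ (norm_nonneg _) (by linarith) two_ne_zero).1 hsq
  have s0 : ∃ u : Fin N, (∃ w : (bondGraph η y).Walk i u, w.length ≤ 0) ∧ ‖x - D u‖ ≤ 63 / 20 :=
    ⟨i, ⟨SimpleGraph.Walk.nil, by simp⟩, hx⟩
  have s1 := step 0 (63 / 20) (318 / 125) (by norm_num) (by norm_num) (by norm_num)
    (by rw [hc]; norm_num) s0
  have s2 := step 1 (318 / 125) (1969 / 1000) (by norm_num) (by norm_num) (by norm_num)
    (by rw [hc]; norm_num) s1
  have s3 := step 2 (1969 / 1000) (1447 / 1000) (by norm_num) (by norm_num) (by norm_num)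
    (by rw [hc]; norm_num) s2
  have s4 := step 3 (1447 / 1000) (128 / 125) (by norm_num) (by norm_num) (by norm_num)
    (by rw [hc]; norm_num) s3
  exact step 4 (128 / 125) (31 / 40) (by norm_num) (by norm_num) (by norm_num)
    (by rw [hc]; norm_num) s4

end RealBall

end Summit.AtomisticToContinuum.Crystallization.Theorems
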